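import Summits.AnomalousDissipation.AnomalousDissipation.Theses.PumpedMirror
import Summits.AnomalousDissipation.AnomalousDissipation.Theorems.TaylorGreenLogLoudStates.Negative.Eigenforce
import Summits.AnomalousDissipation.AnomalousDissipation.Theorems.TaylorCertificatesFloorCertificateStubEigenforceWorkBound
import Literature.Analysis.FluidPDE.StatisticalSolutionEnergyEq
import Summits.AnomalousDissipation.AnomalousDissipation.Theorems.GPStatisticalRigidity.Negative.IntegrableRedundant

/-!
# STRATEGY CENSUS (typed companion) — crux `PumpedMirror.MirrorFloorTG` (stmt-AnomalousDissipation-15372)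

Crux-strategist seat `planner-cstrat-stmt-AnomalousDissipation-15372-s1-0` (2026-08-17). Kernel-checked census
facts; nothing here asserts a Theses statement unconditionally except genuine special cases.
-/

noncomputable section

set_option linter.dupNamespace false

namespace Summit.AnomalousDissipation.AnomalousDissipation.Cruxes.MirrorFloorTG.StrategistCensus

open MeasureTheory Filter Topology UnitAddTorus
open scoped InnerProductSpace RealInnerProductSpace ENNReal NNReal
open Literature.Analysis.FunctionSpaces Literature.Analysis.FunctionSpaces.Torus Literature.Analysis.FluidPDE
open Summit.AnomalousDissipation.AnomalousDissipation.Theses.PumpedMirror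
open Summit.AnomalousDissipation.AnomalousDissipation.Theorems.TaylorGreenLoudGalerkinStates.Negative
  (tgForce tgShell tgCoeff tgForce_eq_realTrigPoly isSmooth_tgForce isDivFree_tgForce hasZeroMean_tgForce
    integral_norm_sq_tgForce continuous_tgForce)
open Summit.AnomalousDissipation.AnomalousDissipation.Theorems.TaylorGreenLogLoudStates.Negative
  (laplacian_tgForce_eq)
open Summit.AnomalousDissipation.AnomalousDissipation.Theorems.TaylorCertificatesFloorCertificate
  (eigenforce_exists_workTest eigenforce_nsGeneratorPairing_self stub_eigenforceWorkBound)
open Summit.AnomalousDissipation.AnomalousDissipation.Theorems.GPStatisticalRigidity.Negative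
  (integrable_norm_sq_of_ensembleEnstrophy_lt_top)

/-- Local notation: real vector fields on `T³`. -/
local notation "Vec3" => (UnitAddTorus (Fin 3)) → (EuclideanSpace ℝ (Fin 3))
/-- Local notation: `L²(T³; ℝ³)`. -/
local notation "L2" => (Lp (EuclideanSpace ℝ (Fin 3)) 2 (volume : Measure (UnitAddTorus (Fin 3))))
/-- Local notation: the energy space `H`. -/
local notation "H3" => (Torus.energySpace (Fin 3))

/-! ## §0 `f_TG` is a Stokes eigenfield, pointwise: `Δ f_TG = −12π² f_TG` -/

/-- `Δ f_TG(x) = −12π² f_TG(x)` for every `x` (the TG shell is `|k|² = 3`). [folklore] -/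
theorem laplacian_tgForce_apply (x : UnitAddTorus (Fin 3)) :
    Torus.laplacian tgForce x = (-(12 * Real.pi ^ 2)) • tgForce x := by
  rw [laplacian_tgForce_eq]
  conv_rhs => rw [tgForce_eq_realTrigPoly]
  have h : ((-(12 * Real.pi ^ 2) : ℝ) • tgCoeff) = ((-(12 * Real.pi ^ 2) : ℝ) : ℂ) • tgCoeff := by
    funext k; rw [Pi.smul_apply, Pi.smul_apply, Complex.coe_smul]
  rw [realTrigPoly_apply, realTrigPoly_apply, h, trigPoly_smul, Pi.smul_apply, Complex.coe_smul, map_smul]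

/-- `‖f_TG‖_{L²}² = 1/4`, as the crux's `∫ ‖f‖²`. -/
theorem tg_norm_sq : (∫ x, ‖tgForce x‖ ^ 2) = 4⁻¹ := integral_norm_sq_tgForce


/-- `f_TG ∈ L²`. -/
theorem memLp_tgForce : MemLp tgForce 2 (volume : Measure (UnitAddTorus (Fin 3))) :=
  isSmooth_tgForce.memLp 2

/-- **The Reynolds stress against `f_TG` is bounded by the energy**: `|I_{f_TG}(u)| ≤ C_TG |u|²` for all
`u ∈ L²`, with `C_TG = sup_x Σᵢ ‖∂ᵢ f_TG(x)‖`. [folklore] -/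
theorem exists_abs_inertialPairing_tg_le :
    ∃ C : ℝ, 0 ≤ C ∧ ∀ u : H3, |Torus.inertialPairing (u : L2) tgForce| ≤ C * ‖u‖ ^ 2 := by
  obtain ⟨C, hC0, hC⟩ := Torus.exists_sum_norm_partialDeriv_le isSmooth_tgForce
  refine ⟨C, hC0, fun u => ?_⟩
  have h := (Torus.integrable_inner_fderiv_apply_coe isSmooth_tgForce hC (u : L2) (u : L2)).2
  rw [Torus.inertialPairing]
  refine h.trans (le_of_eq ?_)
  rw [Submodule.coe_norm, sq]

/-! ## §B SMALL ENERGY: the crux holds with a ν-INDEPENDENT, EXPLICIT certificate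

The floor Lagrangian at the WORK FUNCTIONAL `Φ_W` (`Φ_W'(u) = f_TG` on the ball, one coordinate) and
weight `θ = 0` reads `ν‖∇u‖² + ⟨F_ν(u), f_TG⟩ = ν‖∇u‖² + ¼ − 12π²ν (u, f_TG) + I_{f_TG}(u)`, and
`|I_{f_TG}(u)| ≤ C_TG |u|²`, `|(u,f_TG)| ≤ ½|u|`. Hence for `E ≤ E₁ := 1/(16 (C_TG + 1))` and
`ν < ν₀(E)` the floor `⅛` holds at EVERY state of the ball `|u|² ≤ E` — symmetric or not, finite
enstrophy or not — with ONE certificate chosen before `ν`. Census heading STRENGTHEN: the ν-uniform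
strengthening, refuted on the Leray ball for every force (`FloorCertificate/Negative/Uniform.lean`), is
TRUE on low-energy slabs; census heading DECOMPOSITION: the `E`-axis splits into a settled compact
piece and the crux. -/

/-- **Uniform small-energy floor.** There is `E₁ > 0` such that for every `0 < E ≤ E₁` ONE cylindrical
test functional `Φ` (the work functional on the ball `|u|² ≤ E`) certifies, for every
`0 < ν < ν₀(E)`, the floor `⅛ ≤ ν‖∇u‖² + ⟨F_ν(u), Φ'(u)⟩` at every `u ∈ H` with `|u|² ≤ E`. -/
theorem floor_smallEnergy_uniform :
    ∃ E₁ : ℝ, 0 < E₁ ∧ ∀ E : ℝ, 0 < E → E ≤ E₁ →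
      ∃ (Φ : Torus.CylindricalTest (Fin 3)) (ν₀ : ℝ), 0 < ν₀ ∧
        (∀ u : H3, ‖u‖ ^ 2 ≤ E → Φ.grad u = tgForce) ∧
        ∀ ν : ℝ, 0 < ν → ν < ν₀ → ∀ u : H3, ‖u‖ ^ 2 ≤ E →
          8⁻¹ ≤ ν * (Torus.eGradNormSq ((u : L2) : Vec3)).toReal +
            Torus.nsGeneratorPairing ν tgForce u (Φ.grad u) := by
  obtain ⟨C, hC0, hC⟩ := exists_abs_inertialPairing_tg_le
  refine ⟨1 / (16 * (C + 1)), by positivity, fun E hE hE1 => ?_⟩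
  obtain ⟨Φ, hΦ⟩ := eigenforce_exists_workTest E isSmooth_tgForce isDivFree_tgForce hasZeroMean_tgForce
  set M : ℝ := ‖memLp_tgForce.toLp tgForce‖ with hM
  have hM0 : 0 ≤ M := norm_nonneg _
  refine ⟨Φ, 1 / (16 * (12 * Real.pi ^ 2) * (Real.sqrt E * M + 1)), by positivity, hΦ, ?_⟩
  intro ν hν hνlt u hu
  rw [hΦ u hu, eigenforce_nsGeneratorPairing_self ν (12 * Real.pi ^ 2) laplacian_tgForce_apply u, tg_norm_sq]
  -- the three error terms
  have hD : 0 ≤ ν * (Torus.eGradNormSq ((u : L2) : Vec3)).toReal := by positivity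
  have hI : |Torus.inertialPairing (u : L2) tgForce| ≤ 16⁻¹ := by
    refine (hC u).trans ?_
    have hu' : ‖u‖ ^ 2 ≤ 1 / (16 * (C + 1)) := hu.trans hE1
    calc C * ‖u‖ ^ 2 ≤ (C + 1) * ‖u‖ ^ 2 := by nlinarith [sq_nonneg ‖u‖]
      _ ≤ (C + 1) * (1 / (16 * (C + 1))) := mul_le_mul_of_nonneg_left hu' (by positivity)
      _ = 16⁻¹ := by field_simp
  have hP : |ν * (-(12 * Real.pi ^ 2) * Torus.pairing (u : L2) tgForce)| ≤ 16⁻¹ := by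
    have h1 : |Torus.pairing (u : L2) tgForce| ≤ Real.sqrt E * M := by
      refine (Torus.abs_pairing_coe_le memLp_tgForce u).trans (mul_le_mul_of_nonneg_right ?_ hM0)
      rw [← Real.sqrt_sq (norm_nonneg u)]
      exact Real.sqrt_le_sqrt hu
    rw [abs_mul, abs_mul, abs_of_pos hν, abs_neg, abs_of_pos (by positivity : (0 : ℝ) < 12 * Real.pi ^ 2),
      ← mul_assoc]
    have h2 : ν * (12 * Real.pi ^ 2) * (Real.sqrt E * M + 1) ≤ 16⁻¹ := by
      have h3 : ν * (16 * (12 * Real.pi ^ 2) * (Real.sqrt E * M + 1)) ≤ 1 := by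
        rw [← le_div_iff₀ (by positivity)]; exact (le_of_lt hνlt).trans (le_of_eq (by ring))
      nlinarith
    calc ν * (12 * Real.pi ^ 2) * |Torus.pairing (u : L2) tgForce|
        ≤ ν * (12 * Real.pi ^ 2) * (Real.sqrt E * M) := by
          exact mul_le_mul_of_nonneg_left h1 (by positivity)
      _ ≤ ν * (12 * Real.pi ^ 2) * (Real.sqrt E * M + 1) := by
          exact mul_le_mul_of_nonneg_left (by linarith) (by positivity)
      _ ≤ 16⁻¹ := h2
  have hI' := neg_abs_le (Torus.inertialPairing (u : L2) tgForce)
  have hP' := neg_abs_le (ν * (-(12 * Real.pi ^ 2) * Torus.pairing (u : L2) tgForce))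
  linarith

/-- **`MirrorFloorTG` at small energy** — the crux VERBATIM with the single extra hypothesis
`E ≤ E₁`: a genuine special case, kernel-checked (the census' BC5 entry). The certificate is the
work functional with `θ₁ = 0`; the mirror-symmetry and finite-enstrophy hypotheses are not used. -/
theorem mirrorFloorTG_smallEnergy :
    ∃ E₁ : ℝ, 0 < E₁ ∧
    ∀ f : UnitAddTorus (Fin 3) → EuclideanSpace ℝ (Fin 3), f = (fun x => !₂[(fourier 1 (x 0) : ℂ).im * (fourier 1 (x 1) : ℂ).re * (fourier 1 (x 2) : ℂ).re, -((fourier 1 (x 0) : ℂ).re * (fourier 1 (x 1) : ℂ).im * (fourier 1 (x 2) : ℂ).re), (0 : ℝ)]) → ∀ E : ℝ, 0 < E → E ≤ E₁ → ∃ (ε₀ ν₀ : ℝ), 0 < ε₀ ∧ 0 < ν₀ ∧ ∀ ν : ℝ, 0 < ν → ν < ν₀ → ∃ (Φ₁ : Literature.Analysis.FluidPDE.Torus.CylindricalTest (Fin 3)) (θ₁ : ℝ), θ₁ ≤ 0 ∧ ∀ u : Literature.Analysis.FunctionSpaces.Torus.energySpace (Fin 3), let uf : UnitAddTorus (Fin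 3) → EuclideanSpace ℝ (Fin 3) := ((u : MeasureTheory.Lp (EuclideanSpace ℝ (Fin 3)) 2 (MeasureTheory.volume : MeasureTheory.Measure (UnitAddTorus (Fin 3)))) : UnitAddTorus (Fin 3) → EuclideanSpace ℝ (Fin 3)); let D : ℝ := ν * (Literature.Analysis.FunctionSpaces.Torus.eGradNormSq uf).toReal; let P : ℝ := Literature.Analysis.FluidPDE.Torus.pairing (u : MeasureTheory.Lp (EuclideanSpace ℝ (Fin 3)) 2 (MeasureTheory.volume : MeasureTheory.Measure (UnitAddTorus (Fin 3)))) f - D; (∀ i j : Fin 3, (fun x => uf (Function.update x i (-x i)) j) =ᵐ[MeasureTheory.volume] (fun x => if j = i then -(uf x j) else uf x j)) → Literature.Analysis.FunctionSpaces.Torus.eGradNormSq uf ≠ ⊤ → ‖u‖ ^ 2 ≤ E → ε₀ ≤ D + Literature.Analysis.FluidPDE.Torus.nsGeneratorPairing ν f u (Φ₁.grad u) + 2 * θ₁ * P := by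
  obtain ⟨E₁, hE₁, h⟩ := floor_smallEnergy_uniform
  refine ⟨E₁, hE₁, fun f hf E hE hE1 => ?_⟩
  have hf' : f = tgForce := hf
  subst hf'
  obtain ⟨Φ, ν₀, hν₀, -, hfloor⟩ := h E hE hE1
  refine ⟨8⁻¹, ν₀, by norm_num, hν₀, fun ν hν hνlt => ⟨Φ, 0, le_rfl, fun u _ _ hu => ?_⟩⟩
  have := hfloor ν hν hνlt u hu
  simp only [mul_zero, zero_mul, add_zero]
  exact this

/-! ## §C ANTI-PUMPING (the Marchioro engine transferred to `f_TG`)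

Every relaxed stationary statistic of `NS_ν(f_TG)` — probability measure on `H` carried by a ball, finite
mean enstrophy, cylindrical Liouville identities, integrable work; NO symmetry, NO energy inequality —
satisfies `¼ + ∫ I_{f_TG} dμ ≤ ½ (12π² ν ε(μ))^{1/2}`: statistics of bounded dissipation cancel the force
by Reynolds stress, `∫ I dμ → −¼`. Verbatim instance of the LANDED sibling stub
`TaylorCertificatesFloorCertificate.stub_eigenforceWorkBound` (λ = 12π², `‖f_TG‖² = ¼`). -/

/-- **Anti-pumping for `f_TG`.** -/
theorem antiPumping_tg {ν ρ : ℝ} (hν : 0 < ν) {μ : Measure H3} (hP : IsProbabilityMeasure μ)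
    (hball : ∀ᵐ u ∂μ, ‖u‖ ^ 2 ≤ ρ) (hG : Torus.ensembleEnstrophy μ < ⊤)
    (hL : ∀ Φ : Torus.CylindricalTest (Fin 3),
      Integrable (fun u => Torus.nsGeneratorPairing ν tgForce u (Φ.grad u)) μ ∧
        ∫ u, Torus.nsGeneratorPairing ν tgForce u (Φ.grad u) ∂μ = 0)
    (hW : Integrable (fun u : H3 => Torus.pairing (u : L2) tgForce) μ) :
    4⁻¹ + ∫ u, Torus.inertialPairing (u : L2) tgForce ∂μ ≤
      2⁻¹ * Real.sqrt (12 * Real.pi ^ 2 * ν * Torus.ensembleDissipation ν μ) := by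
  have h := stub_eigenforceWorkBound ν (12 * Real.pi ^ 2) ρ tgForce hν (by positivity) isSmooth_tgForce
    isDivFree_tgForce hasZeroMean_tgForce laplacian_tgForce_apply μ hP hball hG hL hW
  rw [tg_norm_sq] at h
  refine h.trans (le_of_eq ?_)
  rw [Real.sqrt_mul (by norm_num), show (4⁻¹ : ℝ) = 2⁻¹ ^ 2 by norm_num, Real.sqrt_sq (by norm_num)]
  ring_nf


/-! ## §D THE FREE FLOOR IS `O(ν)` (fixed-viscosity loudness of every relaxed statistic of `f_TG`)

From anti-pumping, `|I_{f_TG}(u)| ≤ C_TG |u|²` and Poincaré in the mean (`4π² ∫|u|² dμ ≤ ∫‖∇u‖² dμ`):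
`¼ ≤ C_TG ε(μ)/(4π²ν) + ½ (12π²ν ε(μ))^{1/2}`, whence `ε(μ) ≥ c ν` for `ν ≤ 1/64`, with `c` depending on
`f_TG` only — for EVERY relaxed statistic on EVERY ball, symmetric or not. Census heading TRANSFER (the
fixed-ν sibling of the step is settled; the crux is exactly the upgrade `cν ↦ ε₀(E)`), and NEGATION (no quiet
relaxed statistic exists at any fixed `ν`; every kill must be a `ν → 0` family). -/

/-- **Mean energy is controlled by mean enstrophy** (Poincaré integrated): for a finite measure with finite
mean enstrophy, `4π² ∫ |u|² dμ ≤ (∫⁻ ‖∇u‖² dμ).toReal`. [folklore] -/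
theorem integral_norm_sq_le_ensembleEnstrophy (μ : Measure H3) [IsFiniteMeasure μ]
    (hG : Torus.ensembleEnstrophy μ < ⊤) :
    4 * Real.pi ^ 2 * ∫ u, ‖u‖ ^ 2 ∂μ ≤ (Torus.ensembleEnstrophy μ).toReal := by
  have hmeas := (Torus.measurable_eGradNormSq_coe (d := Fin 3))
  have hint : Integrable (fun v : H3 => (Torus.eGradNormSq ((v : L2) : Vec3)).toReal) μ :=
    integrable_toReal_of_lintegral_ne_top hmeas.aemeasurable hG.ne
  rw [← integral_const_mul, Torus.ensembleEnstrophy,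
    ← integral_toReal hmeas.aemeasurable (ae_lt_top hmeas hG.ne)]
  refine integral_mono_ae ((integrable_norm_sq_of_ensembleEnstrophy_lt_top μ hG).const_mul _) hint ?_
  filter_upwards [ae_lt_top hmeas hG.ne] with v hv
  exact Torus.norm_sq_le_toReal_eGradNormSq v hv.ne

/-- **The implicit fixed-viscosity floor.** For every relaxed statistic of `NS_ν(f_TG)` (no symmetry, no
energy inequality): `¼ ≤ C_TG ε(μ)/(4π²ν) + ½ (12π²ν ε(μ))^{1/2}`. -/
theorem quarter_le_of_relaxed :
    ∃ C : ℝ, 0 ≤ C ∧ ∀ (ν ρ : ℝ) (μ : Measure H3), 0 < ν → IsProbabilityMeasure μ →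
      (∀ᵐ u ∂μ, ‖u‖ ^ 2 ≤ ρ) → Torus.ensembleEnstrophy μ < ⊤ →
      (∀ Φ : Torus.CylindricalTest (Fin 3),
        Integrable (fun u => Torus.nsGeneratorPairing ν tgForce u (Φ.grad u)) μ ∧
          ∫ u, Torus.nsGeneratorPairing ν tgForce u (Φ.grad u) ∂μ = 0) →
      Integrable (fun u : H3 => Torus.pairing (u : L2) tgForce) μ →
      4⁻¹ ≤ C * (Torus.ensembleDissipation ν μ / (4 * Real.pi ^ 2 * ν)) +
        2⁻¹ * Real.sqrt (12 * Real.pi ^ 2 * ν * Torus.ensembleDissipation ν μ) := by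
  obtain ⟨C, hC0, hC⟩ := exists_abs_inertialPairing_tg_le
  refine ⟨C, hC0, fun ν ρ μ hν hP hball hG hL hW => ?_⟩
  have hA := antiPumping_tg hν hP hball hG hL hW
  -- `∫ I dμ ≥ -C ∫ |u|² dμ ≥ -C ε/(4π²ν)`
  have hIint : Integrable (fun u : H3 => Torus.inertialPairing (u : L2) tgForce) μ := by
    refine Integrable.mono' ((integrable_norm_sq_of_ensembleEnstrophy_lt_top μ hG).const_mul C)
      (Torus.continuous_inertialPairing_coe isSmooth_tgForce).aestronglyMeasurable ?_
    exact ae_of_all _ fun u => by rw [Real.norm_eq_abs]; exact hC u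
  have hI : -(C * ∫ u, ‖u‖ ^ 2 ∂μ) ≤ ∫ u, Torus.inertialPairing (u : L2) tgForce ∂μ := by
    rw [← integral_const_mul, ← integral_neg]
    refine integral_mono ((integrable_norm_sq_of_ensembleEnstrophy_lt_top μ hG).const_mul C).neg hIint
      fun u => ?_
    have := neg_abs_le (Torus.inertialPairing (u : L2) tgForce)
    dsimp only
    linarith [hC u]
  have hE := integral_norm_sq_le_ensembleEnstrophy μ hG
  have hE' : C * ∫ u, ‖u‖ ^ 2 ∂μ ≤ C * (Torus.ensembleDissipation ν μ / (4 * Real.pi ^ 2 * ν)) := by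
    refine mul_le_mul_of_nonneg_left ?_ hC0
    rw [Torus.ensembleDissipation, le_div_iff₀ (by positivity)]
    nlinarith
  linarith

/-- **THE FREE FLOOR IS `O(ν)`.** There is `c > 0` (depending on `f_TG` only) such that for every
`0 < ν ≤ 1/64` every relaxed statistic of `NS_ν(f_TG)` on any ball — probability, finite mean enstrophy,
cylindrical Liouville identities, integrable work; no symmetry, no energy inequality — dissipates at least
`c ν`. The crux asks for `ε₀(E)` in place of `c ν`: its entire open content is the uniformity in `ν`. -/
theorem fixedViscosity_floor :
    ∃ c : ℝ, 0 < c ∧ ∀ (ν ρ : ℝ) (μ : Measure H3), 0 < ν → ν ≤ 64⁻¹ → IsProbabilityMeasure μ →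
      (∀ᵐ u ∂μ, ‖u‖ ^ 2 ≤ ρ) → Torus.ensembleEnstrophy μ < ⊤ →
      (∀ Φ : Torus.CylindricalTest (Fin 3),
        Integrable (fun u => Torus.nsGeneratorPairing ν tgForce u (Φ.grad u)) μ ∧
          ∫ u, Torus.nsGeneratorPairing ν tgForce u (Φ.grad u) ∂μ = 0) →
      Integrable (fun u : H3 => Torus.pairing (u : L2) tgForce) μ →
      c * ν ≤ Torus.ensembleDissipation ν μ := by
  obtain ⟨C, hC0, hC⟩ := quarter_le_of_relaxed
  refine ⟨min 1 (Real.pi ^ 2 / (2 * (C + 1))), lt_min one_pos (by positivity),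
    fun ν ρ μ hν hν64 hP hball hG hL hW => ?_⟩
  have h := hC ν ρ μ hν hP hball hG hL hW
  set ε := Torus.ensembleDissipation ν μ with hε
  have hε0 : 0 ≤ ε := by rw [hε, Torus.ensembleDissipation]; positivity
  by_contra hlt
  rw [not_le] at hlt
  have hεν : ε < ν := hlt.trans_le (by nlinarith [min_le_left (1 : ℝ) (Real.pi ^ 2 / (2 * (C + 1)))])
  -- the square-root term is `≤ 1/8`
  have hsq : 2⁻¹ * Real.sqrt (12 * Real.pi ^ 2 * ν * ε) ≤ 8⁻¹ := by
    have h1 : 12 * Real.pi ^ 2 * ν * ε ≤ (16 * ν) ^ 2 := by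
      have hpi : Real.pi ^ 2 ≤ 16 := by nlinarith [Real.pi_lt_four, Real.pi_pos]
      nlinarith [mul_le_mul_of_nonneg_left hεν.le (by positivity : (0 : ℝ) ≤ 12 * Real.pi ^ 2 * ν)]
    have h2 : Real.sqrt (12 * Real.pi ^ 2 * ν * ε) ≤ 16 * ν := by
      rw [← Real.sqrt_sq (by positivity : (0 : ℝ) ≤ 16 * ν)]
      exact Real.sqrt_le_sqrt h1
    nlinarith
  -- hence the stress term carries `1/8`, forcing `ε ≥ π² ν/(2(C+1))`
  have hC8 : 8⁻¹ ≤ C * (ε / (4 * Real.pi ^ 2 * ν)) := by linarith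
  have hεlow : Real.pi ^ 2 / (2 * (C + 1)) * ν ≤ ε := by
    rw [div_mul_eq_mul_div, div_le_iff₀ (by positivity)]
    have h3 : 8⁻¹ * (4 * Real.pi ^ 2 * ν) ≤ C * ε := by
      rw [← mul_div_assoc] at hC8
      exact (le_div_iff₀ (by positivity)).1 hC8
    nlinarith
  have : min 1 (Real.pi ^ 2 / (2 * (C + 1))) * ν ≤ ε :=
    (mul_le_mul_of_nonneg_right (min_le_right _ _) hν.le).trans hεlow
  linarith

/-! ## §E SMALL ENERGY, DUAL SIDE: the relaxed class is EMPTY (so S3 holds vacuously there)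

With the energy inequality `ε(μ) ≤ ∫(u,f_TG) dμ ≤ ½ √ρ` and `|I| ≤ C_TG ρ` on the ball, anti-pumping reads
`¼ ≤ C_TG ρ + ½ (12π²ν · ½√ρ)^{1/2}`: impossible for `ρ ≤ 1/(16(C_TG+1))` and small `ν`. -/

/-- **No relaxed statistic of small energy.** -/
theorem relaxed_empty_smallEnergy :
    ∃ ρ₁ : ℝ, 0 < ρ₁ ∧ ∀ ρ : ℝ, 0 ≤ ρ → ρ ≤ ρ₁ → ∀ (ν : ℝ) (μ : Measure H3), 0 < ν → ν ≤ 64⁻¹ →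
      IsProbabilityMeasure μ → (∀ᵐ u ∂μ, ‖u‖ ^ 2 ≤ ρ) → Torus.ensembleEnstrophy μ < ⊤ →
      (∀ Φ : Torus.CylindricalTest (Fin 3),
        Integrable (fun u => Torus.nsGeneratorPairing ν tgForce u (Φ.grad u)) μ ∧
          ∫ u, Torus.nsGeneratorPairing ν tgForce u (Φ.grad u) ∂μ = 0) →
      Integrable (fun u : H3 => Torus.pairing (u : L2) tgForce) μ →
      Torus.ensembleDissipation ν μ ≤ ∫ u, Torus.pairing (u : L2) tgForce ∂μ → False := by
  obtain ⟨C, hC0, hC⟩ := exists_abs_inertialPairing_tg_le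
  set M : ℝ := ‖memLp_tgForce.toLp tgForce‖ with hM
  have hM0 : 0 ≤ M := norm_nonneg _
  refine ⟨min (1 / (16 * (C + 1))) ((1 / (256 * (M + 1))) ^ 2), lt_min (by positivity) (by positivity),
    fun ρ hρ0 hρ1 ν μ hν hν64 hP hball hG hL hW hEI => ?_⟩
  have hA := antiPumping_tg hν hP hball hG hL hW
  -- `∫ I ≥ -C ρ`
  have hIint : Integrable (fun u : H3 => Torus.inertialPairing (u : L2) tgForce) μ := by
    refine Integrable.mono' (integrable_const (C * ρ))
      (Torus.continuous_inertialPairing_coe isSmooth_tgForce).aestronglyMeasurable ?_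
    filter_upwards [hball] with u hu
    rw [Real.norm_eq_abs]
    exact (hC u).trans (mul_le_mul_of_nonneg_left hu hC0)
  have hI : -(C * ρ) ≤ ∫ u, Torus.inertialPairing (u : L2) tgForce ∂μ := by
    have h1 : ∫ _ : H3, -(C * ρ) ∂μ ≤ ∫ u, Torus.inertialPairing (u : L2) tgForce ∂μ := by
      refine integral_mono_ae (integrable_const _) hIint ?_
      filter_upwards [hball] with u hu
      have := neg_abs_le (Torus.inertialPairing (u : L2) tgForce)
      linarith [(hC u).trans (mul_le_mul_of_nonneg_left hu hC0)]
    simpa using h1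
  -- `∫ (u,f) ≤ √ρ M`
  have hWle : ∫ u, Torus.pairing (u : L2) tgForce ∂μ ≤ Real.sqrt ρ * M := by
    have h1 : ∫ u, Torus.pairing (u : L2) tgForce ∂μ ≤ ∫ _ : H3, Real.sqrt ρ * M ∂μ := by
      refine integral_mono_ae hW (integrable_const _) ?_
      filter_upwards [hball] with u hu
      refine (le_abs_self _).trans ((Torus.abs_pairing_coe_le memLp_tgForce u).trans ?_)
      refine mul_le_mul_of_nonneg_right ?_ hM0
      rw [← Real.sqrt_sq (norm_nonneg u)]
      exact Real.sqrt_le_sqrt hu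
    simpa using h1
  have hε := hEI.trans hWle
  -- `√ρ ≤ 1/(16(M+1))` and `ρ ≤ 1/(16(C+1))`
  have hρC : C * ρ ≤ 16⁻¹ := by
    calc C * ρ ≤ (C + 1) * ρ := by nlinarith
      _ ≤ (C + 1) * (1 / (16 * (C + 1))) :=
          mul_le_mul_of_nonneg_left (hρ1.trans (min_le_left _ _)) (by positivity)
      _ = 16⁻¹ := by field_simp
  have hρM : Real.sqrt ρ * M ≤ 256⁻¹ := by
    have h1 : Real.sqrt ρ ≤ 1 / (256 * (M + 1)) := by
      rw [← Real.sqrt_sq (by positivity : (0 : ℝ) ≤ 1 / (256 * (M + 1)))]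
      exact Real.sqrt_le_sqrt (hρ1.trans (min_le_right _ _))
    calc Real.sqrt ρ * M ≤ 1 / (256 * (M + 1)) * M := mul_le_mul_of_nonneg_right h1 hM0
      _ ≤ 1 / (256 * (M + 1)) * (M + 1) := mul_le_mul_of_nonneg_left (by linarith) (by positivity)
      _ = 256⁻¹ := by field_simp
  -- the square-root term: `12π²ν ε ≤ 12·16·(1/64)·(1/256) ≤ (1/4)²`
  have hsq : 2⁻¹ * Real.sqrt (12 * Real.pi ^ 2 * ν * Torus.ensembleDissipation ν μ) ≤ 8⁻¹ := by
    have hε0 : 0 ≤ Torus.ensembleDissipation ν μ := by rw [Torus.ensembleDissipation]; positivity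
    have h1 : 12 * Real.pi ^ 2 * ν * Torus.ensembleDissipation ν μ ≤ (4⁻¹) ^ 2 := by
      have hpi : Real.pi ^ 2 ≤ 16 := by nlinarith [Real.pi_lt_four, Real.pi_pos]
      have h2 : Torus.ensembleDissipation ν μ ≤ 256⁻¹ := hε.trans hρM
      have a1 : 12 * Real.pi ^ 2 * ν ≤ 12 * 16 * 64⁻¹ := by
        nlinarith [mul_nonneg (sub_nonneg.2 hpi) hν.le]
      have a2 : 12 * Real.pi ^ 2 * ν * Torus.ensembleDissipation ν μ ≤ 12 * 16 * 64⁻¹ * 256⁻¹ :=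
        mul_le_mul a1 h2 hε0 (by norm_num)
      exact a2.trans (by norm_num)
    have h2 : Real.sqrt (12 * Real.pi ^ 2 * ν * Torus.ensembleDissipation ν μ) ≤ 4⁻¹ := by
      rw [← Real.sqrt_sq (by norm_num : (0 : ℝ) ≤ 4⁻¹)]
      exact Real.sqrt_le_sqrt h1
    linarith
  linarith

/-- **S3 (`stub_mirrorLawsLoudTG`) at small energy** — the registered stub's statement VERBATIM with the
single extra hypothesis `E ≤ E₁`: vacuously true (no relaxed K-statistic of energy `≤ E₁` exists). -/
theorem mirrorLawsLoudTG_smallEnergy :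
    ∃ E₁ : ℝ, 0 < E₁ ∧
    ∀ f : UnitAddTorus (Fin 3) → EuclideanSpace ℝ (Fin 3),
      f = (fun x => !₂[(fourier 1 (x 0) : ℂ).im * (fourier 1 (x 1) : ℂ).re * (fourier 1 (x 2) : ℂ).re,
        -((fourier 1 (x 0) : ℂ).re * (fourier 1 (x 1) : ℂ).im * (fourier 1 (x 2) : ℂ).re), (0 : ℝ)]) →
    ∀ E : ℝ, 0 < E → E ≤ E₁ → ∃ ε₀ ν₀ : ℝ, 0 < ε₀ ∧ 0 < ν₀ ∧ ∀ ν : ℝ, 0 < ν → ν < ν₀ →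
      ∀ μ : Measure (Torus.energySpace (Fin 3)), IsProbabilityMeasure μ →
        (∀ᵐ u ∂μ, ∀ i j : Fin 3,
          (fun x => (u.1 : UnitAddTorus (Fin 3) → EuclideanSpace ℝ (Fin 3)) (Function.update x i (-x i)) j)
            =ᵐ[volume]
          (fun x => if j = i then -((u.1 : UnitAddTorus (Fin 3) → EuclideanSpace ℝ (Fin 3)) x j)
            else (u.1 : UnitAddTorus (Fin 3) → EuclideanSpace ℝ (Fin 3)) x j)) →
        (∀ᵐ u ∂μ, ‖u‖ ^ 2 ≤ E) →
        Torus.ensembleEnstrophy μ < ⊤ →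
        (∀ Φ : Torus.CylindricalTest (Fin 3),
          Integrable (fun u => Torus.nsGeneratorPairing ν f u (Φ.grad u)) μ ∧
            ∫ u, Torus.nsGeneratorPairing ν f u (Φ.grad u) ∂μ = 0) →
        Integrable (fun u : Torus.energySpace (Fin 3) => Torus.pairing u.1 f) μ →
        Torus.ensembleDissipation ν μ ≤ ∫ u, Torus.pairing u.1 f ∂μ →
        ε₀ ≤ Torus.ensembleDissipation ν μ := by
  obtain ⟨ρ₁, hρ₁, h⟩ := relaxed_empty_smallEnergy
  refine ⟨ρ₁, hρ₁, fun f hf E hE hE1 => ?_⟩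
  have hf' : f = tgForce := hf
  subst hf'
  refine ⟨1, 64⁻¹, one_pos, by norm_num, fun ν hν hνlt μ hP _ hball hG hL hW hEI => ?_⟩
  exact (h E hE.le hE1 ν μ hν hνlt.le hP hball hG hL hW hEI).elim

/-! ## §F WEAK DUALITY ON THE SLAB: S3 is NECESSARY for the crux (the live line loses nothing)

Integrating the floor inequality against a relaxed K-statistic: the Liouville term vanishes, the energy
channel is signed (`θ ≤ 0`, `ε(μ) ≤ ∫(u,f)dμ`), so `ε₀ ≤ ε(μ)`. Relaxed-slab form of the landed
`FloorCertificate/Negative/WeakDuality.floorFamily_le_ensembleDissipation`. -/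

/-- **Weak duality on a carrier.** A floor certified on `S ∩ {|u|² ≤ E} ∩ {‖∇u‖ < ∞}` bounds below the
dissipation of every relaxed statistic carried by `S ∩ {|u|² ≤ E}`. -/
theorem weakDuality_on {ν E ε₀ θ : ℝ} {f : Vec3} {S : Set H3} {Φ : Torus.CylindricalTest (Fin 3)}
    (hθ : θ ≤ 0)
    (hfloor : ∀ u : H3, u ∈ S → Torus.eGradNormSq ((u : L2) : Vec3) ≠ ⊤ → ‖u‖ ^ 2 ≤ E →
      ε₀ ≤ ν * (Torus.eGradNormSq ((u : L2) : Vec3)).toReal + Torus.nsGeneratorPairing ν f u (Φ.grad u) +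
        2 * θ * (Torus.pairing (u : L2) f - ν * (Torus.eGradNormSq ((u : L2) : Vec3)).toReal))
    {μ : Measure H3} [IsProbabilityMeasure μ] (hS : ∀ᵐ u ∂μ, u ∈ S) (hball : ∀ᵐ u ∂μ, ‖u‖ ^ 2 ≤ E)
    (hG : Torus.ensembleEnstrophy μ < ⊤)
    (hL : Integrable (fun u => Torus.nsGeneratorPairing ν f u (Φ.grad u)) μ ∧
      ∫ u, Torus.nsGeneratorPairing ν f u (Φ.grad u) ∂μ = 0)
    (hW : Integrable (fun u : H3 => Torus.pairing (u : L2) f) μ)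
    (hEI : Torus.ensembleDissipation ν μ ≤ ∫ u, Torus.pairing (u : L2) f ∂μ) :
    ε₀ ≤ Torus.ensembleDissipation ν μ := by
  have hmeas := (Torus.measurable_eGradNormSq_coe (d := Fin 3))
  set D : H3 → ℝ := fun u => ν * (Torus.eGradNormSq ((u : L2) : Vec3)).toReal with hDdef
  have hDint : Integrable D μ :=
    (integrable_toReal_of_lintegral_ne_top hmeas.aemeasurable hG.ne).const_mul ν
  have hDeq : ∫ u, D u ∂μ = Torus.ensembleDissipation ν μ := by
    rw [hDdef, integral_const_mul, Torus.ensembleDissipation, Torus.ensembleEnstrophy,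
      integral_toReal hmeas.aemeasurable (ae_lt_top hmeas hG.ne)]
  have hAE : ∀ᵐ u ∂μ, ε₀ ≤ D u + Torus.nsGeneratorPairing ν f u (Φ.grad u) +
      2 * θ * (Torus.pairing (u : L2) f - D u) := by
    filter_upwards [hS, hball, ae_lt_top hmeas hG.ne] with u hu hb hfin
    exact hfloor u hu hfin.ne hb
  have hI : ∫ _ : H3, ε₀ ∂μ ≤ ∫ u, (D u + Torus.nsGeneratorPairing ν f u (Φ.grad u) +
      2 * θ * (Torus.pairing (u : L2) f - D u)) ∂μ :=
    integral_mono_ae (integrable_const _) ((hDint.add hL.1).add ((hW.sub hDint).const_mul _)) hAE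
  rw [integral_const, probReal_univ, one_smul,
    integral_add (f := fun u : H3 => D u + Torus.nsGeneratorPairing ν f u (Φ.grad u))
      (g := fun u : H3 => 2 * θ * (Torus.pairing (u : L2) f - D u)) (hDint.add hL.1) ((hW.sub hDint).const_mul _),
    integral_add hDint hL.1, integral_const_mul (2 * θ) (fun u : H3 => Torus.pairing (u : L2) f - D u),
    integral_sub hW hDint, hL.2, hDeq] at hI
  have hchan : 2 * θ * ((∫ u, Torus.pairing (u : L2) f ∂μ) - Torus.ensembleDissipation ν μ) ≤ 0 := by
    have h1 : 0 ≤ (∫ u, Torus.pairing (u : L2) f ∂μ) - Torus.ensembleDissipation ν μ := by linarith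
    nlinarith
  linarith

/-- **`MirrorFloorTG` ⇒ S3** (`stub_mirrorLawsLoudTG`'s registered statement, verbatim): the open stub of
the live line is NECESSARY for the crux — given S1a–S1c and S2 it is EQUIVALENT to it. -/
theorem mirrorLawsLoudTG_of_mirrorFloorTG (hA : MirrorFloorTG) :
    ∀ f : UnitAddTorus (Fin 3) → EuclideanSpace ℝ (Fin 3),
      f = (fun x => !₂[(fourier 1 (x 0) : ℂ).im * (fourier 1 (x 1) : ℂ).re * (fourier 1 (x 2) : ℂ).re,
        -((fourier 1 (x 0) : ℂ).re * (fourier 1 (x 1) : ℂ).im * (fourier 1 (x 2) : ℂ).re), (0 : ℝ)]) →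
    ∀ E : ℝ, 0 < E → ∃ ε₀ ν₀ : ℝ, 0 < ε₀ ∧ 0 < ν₀ ∧ ∀ ν : ℝ, 0 < ν → ν < ν₀ →
      ∀ μ : Measure (Torus.energySpace (Fin 3)), IsProbabilityMeasure μ →
        (∀ᵐ u ∂μ, ∀ i j : Fin 3,
          (fun x => (u.1 : UnitAddTorus (Fin 3) → EuclideanSpace ℝ (Fin 3)) (Function.update x i (-x i)) j)
            =ᵐ[volume]
          (fun x => if j = i then -((u.1 : UnitAddTorus (Fin 3) → EuclideanSpace ℝ (Fin 3)) x j)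
            else (u.1 : UnitAddTorus (Fin 3) → EuclideanSpace ℝ (Fin 3)) x j)) →
        (∀ᵐ u ∂μ, ‖u‖ ^ 2 ≤ E) →
        Torus.ensembleEnstrophy μ < ⊤ →
        (∀ Φ : Torus.CylindricalTest (Fin 3),
          Integrable (fun u => Torus.nsGeneratorPairing ν f u (Φ.grad u)) μ ∧
            ∫ u, Torus.nsGeneratorPairing ν f u (Φ.grad u) ∂μ = 0) →
        Integrable (fun u : Torus.energySpace (Fin 3) => Torus.pairing u.1 f) μ →
        Torus.ensembleDissipation ν μ ≤ ∫ u, Torus.pairing u.1 f ∂μ →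
        ε₀ ≤ Torus.ensembleDissipation ν μ := by
  intro f hf E hE
  obtain ⟨ε₀, ν₀, hε₀, hν₀, hfl⟩ := hA f hf E hE
  refine ⟨ε₀, ν₀, hε₀, hν₀, fun ν hν hνlt μ hP hsym hball hG hL hW hEI => ?_⟩
  obtain ⟨Φ, θ, hθ, hfloor⟩ := hfl ν hν hνlt
  set S : Set H3 := {u : H3 | ∀ i j : Fin 3,
    (fun x => (u.1 : UnitAddTorus (Fin 3) → EuclideanSpace ℝ (Fin 3)) (Function.update x i (-x i)) j)
      =ᵐ[volume]
    (fun x => if j = i then -((u.1 : UnitAddTorus (Fin 3) → EuclideanSpace ℝ (Fin 3)) x j)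
      else (u.1 : UnitAddTorus (Fin 3) → EuclideanSpace ℝ (Fin 3)) x j)} with hSdef
  have hS : ∀ᵐ u ∂μ, u ∈ S := hsym
  exact weakDuality_on (S := S) hθ (fun u hu hfin hb => hfloor u hu hfin hb) hS hball hG (hL Φ) hW hEI


/-! ## §G THE BEST TYPED SPLIT OF S3 (census heading DECOMPOSITION) — input floor ∧ leak ceiling

`ε(μ) = ∫(u,f)dμ − leak(μ)`, `leak ≥ 0` by the relaxed energy inequality. S3 follows from an INPUT FLOOR
(every relaxed K-statistic keeps `O(1)` correlation with the force) and a LEAK CEILING (relaxed K-statistics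
are asymptotically honest). The glue is two lines; the census records why neither piece is easier than S3
(the input floor has decorrelated stress-carrying statistics as enemies; the leak ceiling is a finite-`ν`
energy-equality statement, known only in `d = 2`) and why the split is LOSSY (S3 ⇏ leak ceiling). NOT filed. -/

/-- The relaxed stationary K-statistics of `NS_ν(f_TG)` below energy `E` (the hypotheses of S3, bundled). -/
def IsRelaxedK (ν E : ℝ) (μ : Measure H3) : Prop :=
  IsProbabilityMeasure μ ∧
  (∀ᵐ u ∂μ, ∀ i j : Fin 3,
    (fun x => (u.1 : UnitAddTorus (Fin 3) → EuclideanSpace ℝ (Fin 3)) (Function.update x i (-x i)) j)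
      =ᵐ[volume]
    (fun x => if j = i then -((u.1 : UnitAddTorus (Fin 3) → EuclideanSpace ℝ (Fin 3)) x j)
      else (u.1 : UnitAddTorus (Fin 3) → EuclideanSpace ℝ (Fin 3)) x j)) ∧
  (∀ᵐ u ∂μ, ‖u‖ ^ 2 ≤ E) ∧ Torus.ensembleEnstrophy μ < ⊤ ∧
  (∀ Φ : Torus.CylindricalTest (Fin 3),
    Integrable (fun u => Torus.nsGeneratorPairing ν tgForce u (Φ.grad u)) μ ∧
      ∫ u, Torus.nsGeneratorPairing ν tgForce u (Φ.grad u) ∂μ = 0) ∧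
  Integrable (fun u : H3 => Torus.pairing (u : L2) tgForce) μ ∧
  Torus.ensembleDissipation ν μ ≤ ∫ u, Torus.pairing (u : L2) tgForce ∂μ

/-- S3 in bundled form (definitionally the registered `stub_mirrorLawsLoudTG` modulo the sugar binder). -/
def MirrorLawsLoudK : Prop :=
  ∀ E : ℝ, 0 < E → ∃ ε₀ ν₀ : ℝ, 0 < ε₀ ∧ 0 < ν₀ ∧ ∀ ν : ℝ, 0 < ν → ν < ν₀ →
    ∀ μ : Measure H3, IsRelaxedK ν E μ → ε₀ ≤ Torus.ensembleDissipation ν μ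

/-- Sub₁ — INPUT FLOOR: below every energy level, every relaxed K-statistic of `f_TG` at small `ν` injects
at least `ι₀(E) > 0`. Enemy: a stress-carrying statistic decorrelated from the force (second moments allow
it: the census' Gaussian microstructure has mean flow `0`). OPEN. -/
def MirrorInputFloorK : Prop :=
  ∀ E : ℝ, 0 < E → ∃ ι₀ ν₀ : ℝ, 0 < ι₀ ∧ 0 < ν₀ ∧ ∀ ν : ℝ, 0 < ν → ν < ν₀ →
    ∀ μ : Measure H3, IsRelaxedK ν E μ → ι₀ ≤ ∫ u, Torus.pairing (u : L2) tgForce ∂μ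

/-- Sub₂ — LEAK CEILING: the leak `∫(u,f)dμ − ε(μ)` of relaxed K-statistics below energy `E` tends to `0`
uniformly as `ν → 0`. A finite-`ν` energy-EQUALITY statement for statistics (FMRT IV (1.31) is an
inequality in `d = 3`; equality known in `d = 2` only); enemy: heavy enstrophy tails (`∫‖∇u‖^{5/2}dμ = ∞`).
OPEN, and NOT implied by S3. -/
def MirrorLeakCeilingK : Prop :=
  ∀ E : ℝ, 0 < E → ∀ η : ℝ, 0 < η → ∃ ν₀ : ℝ, 0 < ν₀ ∧ ∀ ν : ℝ, 0 < ν → ν < ν₀ →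
    ∀ μ : Measure H3, IsRelaxedK ν E μ →
      (∫ u, Torus.pairing (u : L2) tgForce ∂μ) - Torus.ensembleDissipation ν μ ≤ η

/-- **The split composes** (glue, two lines of arithmetic): Sub₁ → Sub₂ → S3 (bundled form). -/
theorem mirrorLawsLoudK_of_split (h₁ : MirrorInputFloorK) (h₂ : MirrorLeakCeilingK) : MirrorLawsLoudK := by
  intro E hE
  obtain ⟨ι₀, ν₀, hι₀, hν₀, hin⟩ := h₁ E hE
  obtain ⟨ν₁, hν₁, hleak⟩ := h₂ E hE (ι₀ / 2) (half_pos hι₀)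
  refine ⟨ι₀ / 2, min ν₀ ν₁, half_pos hι₀, lt_min hν₀ hν₁, fun ν hν hνlt μ hμ => ?_⟩
  have a := hin ν hν (hνlt.trans_le (min_le_left _ _)) μ hμ
  have b := hleak ν hν (hνlt.trans_le (min_le_right _ _)) μ hμ
  linarith

/-- The bundled S3 gives the registered stub statement verbatim. -/
theorem stub_statement_of_mirrorLawsLoudK (h : MirrorLawsLoudK) :
    ∀ f : UnitAddTorus (Fin 3) → EuclideanSpace ℝ (Fin 3),
      f = (fun x => !₂[(fourier 1 (x 0) : ℂ).im * (fourier 1 (x 1) : ℂ).re * (fourier 1 (x 2) : ℂ).re,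
        -((fourier 1 (x 0) : ℂ).re * (fourier 1 (x 1) : ℂ).im * (fourier 1 (x 2) : ℂ).re), (0 : ℝ)]) →
    ∀ E : ℝ, 0 < E → ∃ ε₀ ν₀ : ℝ, 0 < ε₀ ∧ 0 < ν₀ ∧ ∀ ν : ℝ, 0 < ν → ν < ν₀ →
      ∀ μ : Measure (Torus.energySpace (Fin 3)), IsProbabilityMeasure μ →
        (∀ᵐ u ∂μ, ∀ i j : Fin 3,
          (fun x => (u.1 : UnitAddTorus (Fin 3) → EuclideanSpace ℝ (Fin 3)) (Function.update x i (-x i)) j)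
            =ᵐ[volume]
          (fun x => if j = i then -((u.1 : UnitAddTorus (Fin 3) → EuclideanSpace ℝ (Fin 3)) x j)
            else (u.1 : UnitAddTorus (Fin 3) → EuclideanSpace ℝ (Fin 3)) x j)) →
        (∀ᵐ u ∂μ, ‖u‖ ^ 2 ≤ E) →
        Torus.ensembleEnstrophy μ < ⊤ →
        (∀ Φ : Torus.CylindricalTest (Fin 3),
          Integrable (fun u => Torus.nsGeneratorPairing ν f u (Φ.grad u)) μ ∧
            ∫ u, Torus.nsGeneratorPairing ν f u (Φ.grad u) ∂μ = 0) →
        Integrable (fun u : Torus.energySpace (Fin 3) => Torus.pairing u.1 f) μ →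
        Torus.ensembleDissipation ν μ ≤ ∫ u, Torus.pairing u.1 f ∂μ →
        ε₀ ≤ Torus.ensembleDissipation ν μ := by
  intro f hf E hE
  have hf' : f = tgForce := hf
  subst hf'
  obtain ⟨ε₀, ν₀, hε₀, hν₀, hl⟩ := h E hE
  exact ⟨ε₀, ν₀, hε₀, hν₀, fun ν hν hνlt μ hP hsym hball hG hL hW hEI =>
    hl ν hν hνlt μ ⟨hP, hsym, hball, hG, hL, hW, hEI⟩⟩

/-! ## §H KILL SWITCH for refuters (census heading NEGATION): one quiet relaxed K-family kills the crux

Contrapositive of §F: a level `E > 0` at which, for all budgets `(ε₀, ν₀)`, some relaxed K-statistic at some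
`ν < ν₀` dissipates `< ε₀` (e.g. Dirac masses on a quiet bounded steady K-branch along `ν_j → 0`, time
averages of a quiet K-cycle, or a leaky fake) refutes `MirrorFloorTG`. By §D every such family has
`ν_j → 0` (no quiet statistic at fixed `ν`); by §E its energy level is `E > E₁`. -/

/-- **Quiet relaxed K-statistics kill the crux.** -/
theorem not_mirrorFloorTG_of_quiet
    (hq : ∃ E : ℝ, 0 < E ∧ ∀ ε₀ ν₀ : ℝ, 0 < ε₀ → 0 < ν₀ → ∃ ν : ℝ, 0 < ν ∧ ν < ν₀ ∧
      ∃ μ : Measure H3, IsRelaxedK ν E μ ∧ Torus.ensembleDissipation ν μ < ε₀) :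
    ¬ MirrorFloorTG := by
  intro hA
  obtain ⟨E, hE, hq⟩ := hq
  obtain ⟨ε₀, ν₀, hε₀, hν₀, hl⟩ := mirrorLawsLoudTG_of_mirrorFloorTG hA tgForce rfl E hE
  obtain ⟨ν, hν, hνlt, μ, ⟨hP, hsym, hball, hG, hL, hW, hEI⟩, hquiet⟩ := hq ε₀ ν₀ hε₀ hν₀
  have := hl ν hν hνlt μ hP hsym hball hG hL hW hEI
  linarith

end Summit.AnomalousDissipation.AnomalousDissipation.Cruxes.MirrorFloorTG.StrategistCensus

end
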